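import Summits.QuantumFields.YangMills.Theorems.UnitScaleTiltProp7AxialGaugeSup
import Summits.QuantumFields.YangMills.Theorems.UnitScaleTiltProp7AxialGauge
import Summits.QuantumFields.YangMills.Theorems.UnitScaleTiltProp7AxialGaugeFace
import Summits.QuantumFields.YangMills.Theorems.AlphaInputsT3ACv3BoxStokes
import Literature.MathematicalPhysics.QuantumFieldTheory.Balaban1983to89.B8Ineq129
import Literature.MathematicalPhysics.QuantumFieldTheory.Balaban1983to89.T4ReTrLipUnitary
import HarnessLib

/-!
# `AlphaInputsT3ACv3RegionAxialGauge` — STRATEGY B for 2′, NON-ABELIAN (FL) step (n1): THE **REGIONAL** COMB-AXIAL SMALL GAUGE — the axial gauge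
# based at `y` makes every bond variable within `|x − y|₁·δ` of `1` using ONLY the plaquettes of a coordinate box containing the comb fan
# (product-set twin of `Prop7AxialGaugeSup.dist1_mul_inv_le_of_axial`) — lane `pub-balaban3d` ∕ cell `ym3-torus`, seat `ym-ust-19936-w1` (g0)

WHY (HOME `ym-ust-19936-w1/FL-COLLAR-w1-g0.md` §4; OWNER W-SEAT START LIST 2026-08-27T22:29:16Z «(EL): abelian first, then the general free-boundary
exact lift»).  The displayed W-dependent row of 2′∕2′χ is (FL) `AlphaInputsT3AC.InnerFineLiftsT3` — for ALL charged `W ∈ SU(2)^{bonds}`, windowed ONLY on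
the plaquettes with four corners in `Ω_k(h)` (`ChargedT3`).  Every non-abelian route linearises `W` in LOCAL SMALL GAUGES on pieces of `Ω_k(h)`: «in the
axial gauge from a base `y`, the bond variables are within `|x − y|₁·δ` of `1` when the plaquettes are within `δ`» ([Balaban1985Averaging] pp. 24–25,
[Balaban1985RegularSpaces] Lemma 1 p. 79).  The tree's form of this (`Prop7AxialGaugeSup.dist1_mul_inv_le_of_axial`, `dist1_holAt_combLoop_le`) assumes
`PlaqSmall δ` on the WHOLE torus; (FL) only grants the window on a region.  THIS FILE proves the REGIONAL form, with the plaquette hypothesis on a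
coordinate box (product set) exactly as in alpha-2 (g4)'s box-local Stokes calculus `BoxStokes.dist1_holAt_cancel_le_pi`:
* §1 `disp_take_combLoop_mem`: every prefix of the comb loop `Γ_{y,y+v} ∪ [μ] ∪ (−Γ_{y,y+v+e_μ})` has displacement in the lattice box spanned by `0`, `v`,
  `v + e_μ` (B8's `disp_prefix_treeWord_mem` for both combs); `walkEnd_take_combLoop_mem_pi`: hence on the torus all prefix positions lie in any product
  set containing that box around `y`.
* §2 ★ `dist1_holAt_combLoop_le_pi`: the comb-fan Stokes bound `≤ |v|₁·δ` from the plaquettes whose lower-left and upper-right corners lie in the product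
  set (the transposition calculus of `Prop7AxialGaugeSup.dist1_holAt_combLoop_le` run with `BoxStokes.dist1_holAt_cancel_le_pi`; the letter moved through the
  later segments never meets its inverse there: those segments have other directions).
* §3 ★ `dist1_mul_inv_le_of_axial_pi` (relative to a background `U₀`), `dist1_le_of_axial_pi` (absolute: `axialT W y = 1` at both ends of the bond ⟹
  `dist1(W_b) ≤ |x − y|₁·δ`), ★★ `dist1_gaugeActT_axialT_le_pi`: for ANY `W`, the axially gauged field `W^{v₀}`, `v₀ = axialT W y`, has
  `dist1(W^{v₀}_b) ≤ |x − y|₁·δ` at every non-wrapping bond whose comb fan lies in a product set on which the plaquettes of `W` are within `δ` of `1`;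
  `…_of_box`: the same with the product-set hypothesis discharged from the coordinate box of §1.
HONEST FRAMING.  Kernel combinatorics over the tree's torus words; nothing of [Balaban1985Averaging]∕[Balaban1985RegularSpaces] is asserted beyond what is
proved; no smallness threshold (every `δ ≥ 0`).  Count-neutral helper toward R3 2′ (items 19936∕19935∕20520: step (n1) of the non-abelian (FL) architecture,
consumed by the local linearisation of charged data; also the gauge step of the (LL) collar if done gauge-wise); registry untouched; (FL) itself is NOT
proved here; nothing about d = 4, the continuum, or a mass gap; YM₃ on T³ is rung R3, not the Clay problem.

References: T. Bałaban, Commun. Math. Phys. 98 (1985) 17–51 [Balaban1985Averaging] ((8)–(9) pp.18–19, (19)–(20) p.21, pp.24–25); CMP 99 (1985) 75–102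
[Balaban1985RegularSpaces] (Lemma 1 (1.24)–(1.25) p.79); CMP 102 (1985) 277–309 [Balaban1985Variational] ((2), (4) p.278, (18) p.280).
-/

set_option autoImplicit false

noncomputable section

namespace Summit.QuantumFields.YangMills.Theorems.RegionAxialGauge

open Literature.MathematicalPhysics.QuantumFieldTheory.Balaban1983to89
open T4Continuum T4ReflectionCone BlockAveraging LatticeWordStokes
open B10Eq27TorusAxialLog (holT axialT gaugeActT transl rel contourT holT_eq_holAt contourT_eq holT_contourT axialT_self gaugeActT_apply)
open B7Prop1Explicit (treeWord seg revWord l1 e length_treeWord flatMap_congr_of disp disp_append disp_treeWord disp_revWord mem_seg)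
open B8Ineq129 (disp_prefix_treeWord_mem)
open Summit.QuantumFields.YangMills.Theorems.Prop7AxialGaugeSup (revWord_eq_wordRev holAt_walk_append_wordRev seg_natCast_succ seg_neg_succ)
open Summit.QuantumFields.YangMills.Theorems.Prop7AxialGauge (axialT_gaugeActT)
open Summit.QuantumFields.YangMills.Theorems.Prop7AxialGaugeFace (disp_apply_eq_netDisp netDisp_treeWord)
open Summit.QuantumFields.YangMills.Theorems.BoxStokes (dist1_holAt_cancel_le_pi)

/-! ## §1 The comb loop never leaves the lattice box spanned by `0`, `v`, `v + e_μ` -/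

section Words

variable {d : ℕ}

/-- The reversal of a word has the length of the word. [folklore] -/
theorem length_wordRev (w : List (Letter d)) : (wordRev w).length = w.length := by
  simp [wordRev]

/-- A prefix of the reversed word is the reversal of a suffix. [folklore] -/
theorem take_wordRev_eq (w : List (Letter d)) (k : ℕ) :
    (wordRev w).take k = wordRev (w.drop (w.length - k)) := by
  set m := w.length - k with hm
  have hsplit : w = w.take m ++ w.drop m := (List.take_append_drop m w).symm
  by_cases hk : k ≤ w.length
  · have hlen : (wordRev (w.drop m)).length = k := by
      rw [length_wordRev, List.length_drop]; omega
    conv_lhs => rw [hsplit, wordRev_append, ← hlen]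
    rw [List.take_left]
  · push Not at hk
    have hm0 : m = 0 := by omega
    rw [hm0, List.drop_zero, List.take_of_length_le]
    rw [length_wordRev]; omega

/-- `disp (wordRev w) = −disp w` (B7's reversal is the tree's). [folklore] -/
theorem disp_wordRev (w : List (B7Prop1Explicit.Letter d)) : disp (wordRev w) = -disp w := by
  rw [← revWord_eq_wordRev, disp_revWord]

/-- **EVERY PREFIX OF THE COMB LOOP `Γ_{0,v} ∪ [μ] ∪ (−Γ_{0,v+e_μ})` HAS ITS DISPLACEMENT IN THE LATTICE BOX SPANNED BY `0`, `v`, `v + e_μ`**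
(coordinate by coordinate): a prefix is either a prefix of the first comb, or the first comb, the step, and the reversal of a SUFFIX of the second comb —
whose displacement is that of the complementary prefix of the second comb (`B8Ineq129.disp_prefix_treeWord_mem` for both combs).
[cite: Balaban1985Averaging, pp.24-25] -/
theorem disp_take_combLoop_mem (v : B7Prop1Explicit.Site d) (μ : Fin d) (k : ℕ) (κ : Fin d) :
    min 0 (min (v κ) ((v + e μ) κ)) ≤ disp ((treeWord v ++ [(μ, true)] ++ wordRev (treeWord (v + e μ))).take k) κ ∧
      disp ((treeWord v ++ [(μ, true)] ++ wordRev (treeWord (v + e μ))).take k) κ ≤ max 0 (max (v κ) ((v + e μ) κ)) := by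
  have hw' : disp (treeWord v ++ [((μ, true) : B7Prop1Explicit.Letter d)]) = v + e μ := by
    simp [B7Prop1Explicit.Letter.vec]
  generalize hw : v + e μ = w at hw' ⊢
  rw [List.take_append, disp_append, Pi.add_apply]
  simp only [List.length_append, List.length_singleton]
  by_cases hk : k ≤ (treeWord v).length
  · -- a prefix of the first comb
    have h0 : k - ((treeWord v).length + 1) = 0 := by omega
    rw [h0, List.take_zero, B7Prop1Explicit.disp_nil, Pi.zero_apply, add_zero, List.take_append_of_le_length hk]
    have hsplit : treeWord v = (treeWord v).take k ++ (treeWord v).drop k := (List.take_append_drop k _).symm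
    have hb := disp_prefix_treeWord_mem v hsplit κ
    constructor <;> omega
  · -- the first comb, the step, and a prefix of the reversed second comb
    push Not at hk
    rw [List.take_of_length_le (by simp only [List.length_append, List.length_singleton]; omega), hw', take_wordRev_eq, disp_wordRev,
      Pi.neg_apply]
    set m := (treeWord w).length - (k - ((treeWord v).length + 1)) with hm
    have hsplit : treeWord w = (treeWord w).take m ++ (treeWord w).drop m := (List.take_append_drop m _).symm
    have hsum : disp ((treeWord w).take m) κ + disp ((treeWord w).drop m) κ = w κ := by
      have h := congrArg (fun l : List (B7Prop1Explicit.Letter d) => disp l κ) hsplit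
      simp only [disp_treeWord, disp_append, Pi.add_apply] at h
      omega
    have hb := disp_prefix_treeWord_mem w hsplit κ
    constructor <;> omega

end Words

section Torus

variable {P : Params} {j : ℕ}

/-- **ON THE TORUS: ALL PREFIX POSITIONS OF THE COMB LOOP FROM `y` LIE IN ANY PRODUCT SET CONTAINING THE COORDINATE BOX OF §1 AROUND `y`.**
(`walkEnd_apply`: the prefix position is `y +` the prefix displacement, coordinatewise modulo the period.) [cite: Balaban1985Averaging, pp.24-25] -/
theorem walkEnd_take_combLoop_mem_pi {I : Fin P.d → Set (ZMod (P.sitesPerDir j))} (y : Site P j) (v : B7Prop1Explicit.Site P.d) (μ : Fin P.d)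
    (hbox : ∀ (κ : Fin P.d) (t : ℤ), min 0 (min (v κ) ((v + e μ) κ)) ≤ t → t ≤ max 0 (max (v κ) ((v + e μ) κ)) →
      y κ + ((t : ℤ) : ZMod (P.sitesPerDir j)) ∈ I κ) (k : ℕ) :
    walkEnd y ((treeWord v ++ [(μ, true)] ++ wordRev (treeWord (v + e μ))).take k) ∈ {z : Site P j | ∀ κ, z κ ∈ I κ} := by
  intro κ
  rw [walkEnd_apply, ← disp_apply_eq_netDisp]
  obtain ⟨h1, h2⟩ := disp_take_combLoop_mem v μ k κ
  exact hbox κ _ h1 h2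

end Torus

/-! ## §2 The comb-fan Stokes bound from the plaquettes of a product set -/

section Stokes

variable {P : Params} {j : ℕ} {G : Type*} [GaugeGroup G]

/-- **THE COMB-FAN STOKES BOUND, BOX-LOCAL.**  Let `S` be a product set of torus sites, `δ ≥ 0`, and suppose every plaquette whose lower-left and
upper-right corners lie in `S` has its variable within `δ` of `1`.  If every prefix position of the closed word `Γ_{y,y+v} ∪ [y+v, y+v+e_μ] ∪ (−Γ_{y,y+v+e_μ})`
lies in `S`, its holonomy is within `|v|₁·δ` of `1`.  Mechanism = `Prop7AxialGaugeSup.dist1_holAt_combLoop_le` with the transposition step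
`BoxStokes.dist1_holAt_cancel_le_pi`: the step `±e_μ` is moved to its partner through the reversed later segments (directions `≠ μ`, so no earlier partner,
and every transposition stays in the product set), one plaquette of `S` per transposition, after which the word backtracks.
[cite: Balaban1985Averaging, pp.24-25; Balaban1985RegularSpaces, Lemma 1 p.79] -/
theorem dist1_holAt_combLoop_le_pi (U : GaugeField P j G) {I : Fin P.d → Set (ZMod (P.sitesPerDir j))} {δ : ℝ} (hδ : 0 ≤ δ)
    (hU : ∀ q : Plaq P j, q.src ∈ {z : Site P j | ∀ κ, z κ ∈ I κ} →
      (q.src.shift q.μ).shift q.ν ∈ {z : Site P j | ∀ κ, z κ ∈ I κ} → dist1 (GaugeField.plaqHol U q) ≤ δ)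
    (y : Site P j) (v : B7Prop1Explicit.Site P.d) (μ : Fin P.d)
    (hSw : ∀ i, walkEnd y ((treeWord v ++ [(μ, true)] ++ wordRev (treeWord (v + e μ))).take i) ∈ {z : Site P j | ∀ κ, z κ ∈ I κ}) :
    dist1 (holAt U (walk y (treeWord v ++ [(μ, true)] ++ wordRev (treeWord (v + e μ))))) ≤ (l1 v : ℝ) * δ := by
  -- split the comb at the segment of direction `μ` (as in `Prop7AxialGaugeSup.dist1_holAt_combLoop_le`)
  obtain ⟨s, t, hst⟩ := List.append_of_mem (a := μ) (l := (List.finRange P.d).reverse) (by simp)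
  have hnd : (s ++ μ :: t).Nodup := by
    rw [← hst]; exact List.nodup_reverse.mpr (List.nodup_finRange P.d)
  have hμst : μ ∉ s ++ t := (List.nodup_cons.mp (List.nodup_middle.mp hnd)).1
  rw [List.mem_append, not_or] at hμst
  let f : Fin P.d → List (B7Prop1Explicit.Letter P.d) := fun κ => seg κ (v κ)
  have hne : ∀ κ, κ ≠ μ → seg κ ((v + e μ) κ) = f κ := by
    intro κ hκ; simp [f, e, hκ]
  have hμμ : seg μ ((v + e μ) μ) = seg μ (v μ + 1) := by simp [e]
  have h1 : treeWord v = s.flatMap f ++ (seg μ (v μ) ++ t.flatMap f) := by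
    rw [treeWord, hst, List.flatMap_append, List.flatMap_cons]
  have h2 : treeWord (v + e μ) = s.flatMap f ++ (seg μ (v μ + 1) ++ t.flatMap f) := by
    rw [treeWord, hst, List.flatMap_append, List.flatMap_cons, hμμ,
      flatMap_congr_of (s := s) (fun κ hκ => hne κ (fun h => hμst.1 (h ▸ hκ))),
      flatMap_congr_of (s := t) (fun κ hκ => hne κ (fun h => hμst.2 (h ▸ hκ)))]
  set A := s.flatMap f with hA
  set B := t.flatMap f with hB
  -- the later segments have directions in `t`, so the letters `±e_μ` do not occur in `B` nor in its reversal
  have hBdir : ∀ l ∈ B, l.1 ∈ t := by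
    intro l hl
    rw [hB, List.mem_flatMap] at hl
    obtain ⟨κ, hκ, hl⟩ := hl
    rw [mem_seg hl]; exact hκ
  have hμB : ∀ b : Bool, ((μ, b) : B7Prop1Explicit.Letter P.d) ∉ B := fun b h => hμst.2 (hBdir _ h)
  have hμrevB : ∀ b : Bool, ((μ, b) : B7Prop1Explicit.Letter P.d) ∉ wordRev B := by
    intro b h
    simp only [wordRev, List.mem_reverse, List.mem_map] at h
    obtain ⟨l, hl, hfl⟩ := h
    have hl1 : l.1 = μ := by
      have := congrArg Prod.fst hfl
      simpa [Letter.flip] using this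
    exact hμst.2 (hl1 ▸ hBdir l hl)
  -- `|B| ≤ |v|₁`
  have hBlen : (B.length : ℝ) ≤ l1 v := by
    have h : B.length ≤ (treeWord v).length := by rw [h1]; simp; omega
    rw [length_treeWord] at h
    exact_mod_cast h
  have hrevlen : ((wordRev B).length : ℝ) = B.length := by simp [wordRev]
  rcases Int.eq_nat_or_neg (v μ) with ⟨m, hm | hm⟩
  · -- `v_μ = m ≥ 0`: the returning comb is one `+e_μ` longer
    rw [h1, h2, hm, seg_natCast_succ, wordRev_append, wordRev_append, wordRev_append] at hSw ⊢
    have hrw : s.flatMap f ++ (seg μ ↑m ++ B) ++ [(μ, true)] ++ (wordRev B ++ (wordRev [(μ, true)] ++ wordRev (seg μ ↑m)) ++ wordRev A) =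
        (A ++ seg μ m ++ B) ++ (μ, true) :: (wordRev B ++ (Letter.flip (μ, true)) :: (wordRev (seg μ m) ++ wordRev A)) := by
      simp [wordRev_cons, Letter.flip, hA]
    rw [hrw] at hSw ⊢
    refine (dist1_holAt_cancel_le_pi U hδ hU y (μ, true) (wordRev B) (A ++ seg μ m ++ B) (wordRev (seg μ m) ++ wordRev A)
      (by simpa [Letter.flip] using hμrevB false) hSw).1.trans ?_
    have hX : A ++ seg μ ↑m ++ B ++ (wordRev B ++ (wordRev (seg μ ↑m) ++ wordRev A)) =
        (A ++ seg μ m ++ B) ++ (wordRev (A ++ seg μ m ++ B) ++ []) := by simp [wordRev_append]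
    rw [hX, holAt_walk_append_wordRev]
    simp only [walk, holAt_nil, GaugeGroup.dist1_one, add_zero, hrevlen]
    exact mul_le_mul_of_nonneg_right hBlen hδ
  · cases m with
    | zero =>
      -- `v_μ = 0`: same as the first case with `m = 0`
      simp only [Nat.cast_zero, neg_zero] at hm
      rw [h1, h2, hm, show (0 : ℤ) = ((0 : ℕ) : ℤ) by simp, seg_natCast_succ, wordRev_append, wordRev_append, wordRev_append] at hSw ⊢
      have hrw : s.flatMap f ++ (seg μ ((0 : ℕ) : ℤ) ++ B) ++ [(μ, true)] ++
            (wordRev B ++ (wordRev [(μ, true)] ++ wordRev (seg μ ((0 : ℕ) : ℤ))) ++ wordRev A) =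
          (A ++ seg μ ((0 : ℕ) : ℤ) ++ B) ++ (μ, true) :: (wordRev B ++ (Letter.flip (μ, true)) :: (wordRev (seg μ ((0 : ℕ) : ℤ)) ++ wordRev A)) := by
        simp [wordRev_cons, Letter.flip, hA]
      rw [hrw] at hSw ⊢
      refine (dist1_holAt_cancel_le_pi U hδ hU y (μ, true) (wordRev B) (A ++ seg μ ((0 : ℕ) : ℤ) ++ B)
        (wordRev (seg μ ((0 : ℕ) : ℤ)) ++ wordRev A) (by simpa [Letter.flip] using hμrevB false) hSw).1.trans ?_
      have hX : A ++ seg μ ((0 : ℕ) : ℤ) ++ B ++ (wordRev B ++ (wordRev (seg μ ((0 : ℕ) : ℤ)) ++ wordRev A)) =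
          (A ++ seg μ ((0 : ℕ) : ℤ) ++ B) ++ (wordRev (A ++ seg μ ((0 : ℕ) : ℤ) ++ B) ++ []) := by simp [wordRev_append]
      rw [hX, holAt_walk_append_wordRev]
      simp only [walk, holAt_nil, GaugeGroup.dist1_one, add_zero, hrevlen]
      exact mul_le_mul_of_nonneg_right hBlen hδ
    | succ m =>
      -- `v_μ = −(m+1) < 0`: the outgoing comb is one `−e_μ` longer
      have hm' : v μ = -((m : ℤ) + 1) := by rw [hm]; push_cast; ring
      have hsucc : v μ + 1 = -(m : ℤ) := by rw [hm']; ring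
      rw [h1, h2, hsucc, hm', seg_neg_succ, wordRev_append, wordRev_append] at hSw ⊢
      have hrw : s.flatMap f ++ (seg μ (-(m : ℤ)) ++ [(μ, false)] ++ B) ++ [(μ, true)] ++ (wordRev B ++ wordRev (seg μ (-(m : ℤ))) ++ wordRev A) =
          (A ++ seg μ (-(m : ℤ))) ++ (μ, false) :: (B ++ (Letter.flip (μ, false)) :: (wordRev B ++ wordRev (seg μ (-(m : ℤ))) ++ wordRev A)) := by
        simp [Letter.flip, hA]
      rw [hrw] at hSw ⊢
      refine (dist1_holAt_cancel_le_pi U hδ hU y (μ, false) B (A ++ seg μ (-(m : ℤ)))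
        (wordRev B ++ wordRev (seg μ (-(m : ℤ))) ++ wordRev A) (by simpa [Letter.flip] using hμB true) hSw).1.trans ?_
      have hX : A ++ seg μ (-(m : ℤ)) ++ (B ++ (wordRev B ++ wordRev (seg μ (-(m : ℤ))) ++ wordRev A)) =
          (A ++ seg μ (-(m : ℤ)) ++ B) ++ (wordRev (A ++ seg μ (-(m : ℤ)) ++ B) ++ []) := by simp [wordRev_append]
      rw [hX, holAt_walk_append_wordRev]
      simp only [walk, holAt_nil, GaugeGroup.dist1_one, add_zero]
      exact mul_le_mul_of_nonneg_right hBlen hδ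

end Stokes

/-! ## §3 The regional axial bounds on one bond -/

section Axial

variable {P : Params} {j : ℕ} {G : Type*} [GaugeGroup G]

/-- **THE RELATIVE AXIAL BOUND ON ONE BOND, BOX-LOCAL** (product-set twin of `Prop7AxialGaugeSup.dist1_mul_inv_le_of_axial`): plaquette variables of `W`,
`U₀` within `δ_W, δ₀ ≥ 0` of `1` on the plaquettes with extreme corners in the product set `S`, the same comb holonomies from `y` at both endpoints of the
non-wrapping bond `⟨x, μ⟩`, and the comb fan of the bond inside `S` ⟹ `dist1(W_b·U₀,b⁻¹) ≤ |x − y|₁·(δ_W + δ₀)`.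
[cite: Balaban1985Averaging, pp.24-25; Balaban1985RegularSpaces, Lemma 1 (1.25) p.79] -/
theorem dist1_mul_inv_le_of_axial_pi (W U₀ : GaugeField P j G) {I : Fin P.d → Set (ZMod (P.sitesPerDir j))} {δW δ₀ : ℝ} (hδW : 0 ≤ δW) (hδ₀ : 0 ≤ δ₀)
    (hW : ∀ q : Plaq P j, q.src ∈ {z : Site P j | ∀ κ, z κ ∈ I κ} →
      (q.src.shift q.μ).shift q.ν ∈ {z : Site P j | ∀ κ, z κ ∈ I κ} → dist1 (GaugeField.plaqHol W q) ≤ δW)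
    (hU₀ : ∀ q : Plaq P j, q.src ∈ {z : Site P j | ∀ κ, z κ ∈ I κ} →
      (q.src.shift q.μ).shift q.ν ∈ {z : Site P j | ∀ κ, z κ ∈ I κ} → dist1 (GaugeField.plaqHol U₀ q) ≤ δ₀)
    (y x : Site P j) (μ : Fin P.d) (hwrap : (rel y x μ + 1) * 2 ≤ (P.sitesPerDir j : ℤ))
    (hSw : ∀ i, walkEnd y ((treeWord (rel y x) ++ [(μ, true)] ++ wordRev (treeWord (rel y x + e μ))).take i) ∈ {z : Site P j | ∀ κ, z κ ∈ I κ})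
    (hax : axialT W y x = axialT U₀ y x) (hax' : axialT W y (x.shift μ) = axialT U₀ y (x.shift μ)) :
    dist1 (W ⟨x, μ⟩ * (U₀ ⟨x, μ⟩)⁻¹) ≤ (l1 (rel y x) : ℝ) * (δW + δ₀) := by
  rw [Prop7AxialGaugeSup.mul_inv_eq_conj_of_axial W U₀ y x μ hwrap hax hax']
  have hconj : dist1 ((axialT U₀ y x)⁻¹ * (holT W y (contourT y ⟨x, μ⟩) * (holT U₀ y (contourT y ⟨x, μ⟩))⁻¹) * axialT U₀ y x) =
      dist1 (holT W y (contourT y ⟨x, μ⟩) * (holT U₀ y (contourT y ⟨x, μ⟩))⁻¹) := by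
    have h := GaugeGroup.dist1_conj (holT W y (contourT y ⟨x, μ⟩) * (holT U₀ y (contourT y ⟨x, μ⟩))⁻¹) (axialT U₀ y x)⁻¹
    rwa [inv_inv] at h
  rw [hconj]
  have hloopW : dist1 (holT W y (contourT y ⟨x, μ⟩)) ≤ (l1 (rel y x) : ℝ) * δW := by
    rw [holT_eq_holAt, contourT_eq, revWord_eq_wordRev]
    exact dist1_holAt_combLoop_le_pi W hδW hW y (rel y x) μ hSw
  have hloopU : dist1 (holT U₀ y (contourT y ⟨x, μ⟩)) ≤ (l1 (rel y x) : ℝ) * δ₀ := by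
    rw [holT_eq_holAt, contourT_eq, revWord_eq_wordRev]
    exact dist1_holAt_combLoop_le_pi U₀ hδ₀ hU₀ y (rel y x) μ hSw
  calc dist1 (holT W y (contourT y ⟨x, μ⟩) * (holT U₀ y (contourT y ⟨x, μ⟩))⁻¹)
      ≤ dist1 (holT W y (contourT y ⟨x, μ⟩)) + dist1 ((holT U₀ y (contourT y ⟨x, μ⟩))⁻¹) := GaugeGroup.dist1_mul_le _ _
    _ = dist1 (holT W y (contourT y ⟨x, μ⟩)) + dist1 (holT U₀ y (contourT y ⟨x, μ⟩)) := by rw [GaugeGroup.dist1_inv]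
    _ ≤ (l1 (rel y x) : ℝ) * δW + (l1 (rel y x) : ℝ) * δ₀ := add_le_add hloopW hloopU
    _ = (l1 (rel y x) : ℝ) * (δW + δ₀) := by ring

/-- **THE ABSOLUTE AXIAL BOUND ON ONE BOND, BOX-LOCAL**: if `W` is in the axial gauge from `y` at both endpoints of the non-wrapping bond `⟨x, μ⟩`
(`W(Γ_{y,x}) = W(Γ_{y,x+e_μ}) = 1`), its comb fan lies in the product set `S` and the plaquettes of `W` with extreme corners in `S` are within `δ ≥ 0` of
`1`, then `dist1(W_b) ≤ |x − y|₁·δ` — [Balaban1985Averaging] p. 24 «|V₀(x, x + e₂) − 1| < |x₁ − y₁|α₀, …» with the plaquette hypothesis on the box only.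
[cite: Balaban1985Averaging, pp.24-25; Balaban1985RegularSpaces, Lemma 1 p.79] -/
theorem dist1_le_of_axial_pi (W : GaugeField P j G) {I : Fin P.d → Set (ZMod (P.sitesPerDir j))} {δ : ℝ} (hδ : 0 ≤ δ)
    (hW : ∀ q : Plaq P j, q.src ∈ {z : Site P j | ∀ κ, z κ ∈ I κ} →
      (q.src.shift q.μ).shift q.ν ∈ {z : Site P j | ∀ κ, z κ ∈ I κ} → dist1 (GaugeField.plaqHol W q) ≤ δ)
    (y x : Site P j) (μ : Fin P.d) (hwrap : (rel y x μ + 1) * 2 ≤ (P.sitesPerDir j : ℤ))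
    (hSw : ∀ i, walkEnd y ((treeWord (rel y x) ++ [(μ, true)] ++ wordRev (treeWord (rel y x + e μ))).take i) ∈ {z : Site P j | ∀ κ, z κ ∈ I κ})
    (hax : axialT W y x = 1) (hax' : axialT W y (x.shift μ) = 1) :
    dist1 (W ⟨x, μ⟩) ≤ (l1 (rel y x) : ℝ) * δ := by
  have h := holT_contourT W y ⟨x, μ⟩ hwrap
  simp only [PBond.tgt] at h
  rw [hax, hax', inv_one, one_mul, mul_one] at h
  rw [← h, holT_eq_holAt, contourT_eq, revWord_eq_wordRev]
  exact dist1_holAt_combLoop_le_pi W hδ hW y (rel y x) μ hSw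

/-- The plaquette deviations of a gauge-transformed field are those of the field (`U^u(∂p) = u(x)U(∂p)u(x)⁻¹`). [cite: Balaban1985Averaging, (8)-(9) p.19] -/
theorem dist1_plaqHol_gaugeActT (u : GaugeTransf P j G) (W : GaugeField P j G) (q : Plaq P j) :
    dist1 (GaugeField.plaqHol (gaugeActT u W) q) = dist1 (GaugeField.plaqHol W q) := by
  have hq : GaugeField.plaqHol (gaugeActT u W) q = GaugeField.plaqHol (GaugeField.gaugeAct u W) q := rfl
  rw [hq, T4ReTrLipUnitary.plaqHol_gaugeAct]
  exact GaugeGroup.dist1_conj _ _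

/-- **★★ THE REGIONAL AXIAL GAUGE**: for ANY configuration `W` on `T^{(j)}` and base `y`, the axially gauged field `W^{v₀}`, `v₀(x) = W(Γ_{y,x})`
(`B10Eq27TorusAxialLog.axialT`), satisfies `dist1(W^{v₀}_b) ≤ |x − y|₁·δ` at every non-wrapping bond `b = ⟨x, μ⟩` whose comb fan lies in a product set
on which the plaquettes OF `W` are within `δ ≥ 0` of `1` — no hypothesis outside the box.  The local small gauge of every non-abelian (FL) route on a piece of
`Ω_k(h)`. [cite: Balaban1985Averaging, (8) p.19, pp.24-25; Balaban1985Variational, (18) p.280] -/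
theorem dist1_gaugeActT_axialT_le_pi (W : GaugeField P j G) {I : Fin P.d → Set (ZMod (P.sitesPerDir j))} {δ : ℝ} (hδ : 0 ≤ δ)
    (hW : ∀ q : Plaq P j, q.src ∈ {z : Site P j | ∀ κ, z κ ∈ I κ} →
      (q.src.shift q.μ).shift q.ν ∈ {z : Site P j | ∀ κ, z κ ∈ I κ} → dist1 (GaugeField.plaqHol W q) ≤ δ)
    (y x : Site P j) (μ : Fin P.d) (hwrap : (rel y x μ + 1) * 2 ≤ (P.sitesPerDir j : ℤ))
    (hSw : ∀ i, walkEnd y ((treeWord (rel y x) ++ [(μ, true)] ++ wordRev (treeWord (rel y x + e μ))).take i) ∈ {z : Site P j | ∀ κ, z κ ∈ I κ}) :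
    dist1 (gaugeActT (axialT W y) W ⟨x, μ⟩) ≤ (l1 (rel y x) : ℝ) * δ := by
  have hax : ∀ z : Site P j, axialT (gaugeActT (axialT W y) W) y z = 1 := fun z => by
    rw [axialT_gaugeActT, axialT_self, one_mul, mul_inv_cancel]
  refine dist1_le_of_axial_pi (gaugeActT (axialT W y) W) hδ (fun q h1 h2 => ?_) y x μ hwrap hSw (hax x) (hax _)
  rw [dist1_plaqHol_gaugeActT]
  exact hW q h1 h2

/-- **★★ THE REGIONAL AXIAL GAUGE, BOX FORM**: as `dist1_gaugeActT_axialT_le_pi`, with the comb-fan hypothesis discharged from the COORDINATE BOX of §1: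
it suffices that the product set contain, around `y`, the lattice box spanned by `0`, `x − y` and `x − y + e_μ` (relative coordinates `rel y x`).
[cite: Balaban1985Averaging, (8) p.19, pp.24-25; Balaban1985Variational, (18) p.280] -/
theorem dist1_gaugeActT_axialT_le_of_box (W : GaugeField P j G) {I : Fin P.d → Set (ZMod (P.sitesPerDir j))} {δ : ℝ} (hδ : 0 ≤ δ)
    (hW : ∀ q : Plaq P j, q.src ∈ {z : Site P j | ∀ κ, z κ ∈ I κ} →
      (q.src.shift q.μ).shift q.ν ∈ {z : Site P j | ∀ κ, z κ ∈ I κ} → dist1 (GaugeField.plaqHol W q) ≤ δ)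
    (y x : Site P j) (μ : Fin P.d) (hwrap : (rel y x μ + 1) * 2 ≤ (P.sitesPerDir j : ℤ))
    (hbox : ∀ (κ : Fin P.d) (t : ℤ), min 0 (min (rel y x κ) ((rel y x + e μ) κ)) ≤ t → t ≤ max 0 (max (rel y x κ) ((rel y x + e μ) κ)) →
      y κ + ((t : ℤ) : ZMod (P.sitesPerDir j)) ∈ I κ) :
    dist1 (gaugeActT (axialT W y) W ⟨x, μ⟩) ≤ (l1 (rel y x) : ℝ) * δ :=
  dist1_gaugeActT_axialT_le_pi W hδ hW y x μ hwrap (walkEnd_take_combLoop_mem_pi y (rel y x) μ hbox)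

/-- The relative box form for a background: `dist1(W_b·U₀,b⁻¹) ≤ |x − y|₁·(δ_W + δ₀)` with the comb fan discharged from the coordinate box.
[cite: Balaban1985RegularSpaces, Lemma 1 (1.25) p.79] -/
theorem dist1_mul_inv_le_of_axial_of_box (W U₀ : GaugeField P j G) {I : Fin P.d → Set (ZMod (P.sitesPerDir j))} {δW δ₀ : ℝ} (hδW : 0 ≤ δW) (hδ₀ : 0 ≤ δ₀)
    (hW : ∀ q : Plaq P j, q.src ∈ {z : Site P j | ∀ κ, z κ ∈ I κ} →
      (q.src.shift q.μ).shift q.ν ∈ {z : Site P j | ∀ κ, z κ ∈ I κ} → dist1 (GaugeField.plaqHol W q) ≤ δW)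
    (hU₀ : ∀ q : Plaq P j, q.src ∈ {z : Site P j | ∀ κ, z κ ∈ I κ} →
      (q.src.shift q.μ).shift q.ν ∈ {z : Site P j | ∀ κ, z κ ∈ I κ} → dist1 (GaugeField.plaqHol U₀ q) ≤ δ₀)
    (y x : Site P j) (μ : Fin P.d) (hwrap : (rel y x μ + 1) * 2 ≤ (P.sitesPerDir j : ℤ))
    (hbox : ∀ (κ : Fin P.d) (t : ℤ), min 0 (min (rel y x κ) ((rel y x + e μ) κ)) ≤ t → t ≤ max 0 (max (rel y x κ) ((rel y x + e μ) κ)) →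
      y κ + ((t : ℤ) : ZMod (P.sitesPerDir j)) ∈ I κ)
    (hax : axialT W y x = axialT U₀ y x) (hax' : axialT W y (x.shift μ) = axialT U₀ y (x.shift μ)) :
    dist1 (W ⟨x, μ⟩ * (U₀ ⟨x, μ⟩)⁻¹) ≤ (l1 (rel y x) : ℝ) * (δW + δ₀) :=
  dist1_mul_inv_le_of_axial_pi W U₀ hδW hδ₀ hW hU₀ y x μ hwrap (walkEnd_take_combLoop_mem_pi y (rel y x) μ hbox) hax hax'

end Axial

end Summit.QuantumFields.YangMills.Theorems.RegionAxialGauge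

end
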